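import Summits.QuantumFields.YangMills.Theorems.BalabanUVNodesC44IterMhOneStep
import Literature.MathematicalPhysics.QuantumFieldTheory.Balaban1983to89.Node00.BgConstraintOfRecord
import HarnessLib

/-!
# (ℓa-C) ROAD B, FILE F4′-4 — THE k-FREE POLYDISC STABILITY OF THE HOLOMORPHIC TOWER ALONG TRACELESS COMPLEX PERTURBATIONS (the induction over levels)

Cell `pub-ymgap` ∕ `ym-nodeO-ideate`, porter lineage `ymgap-nodeO-port-PTB-1` (gen 7), hand «(44) for `iterMh`» (director-ym g22 №569/№571; PORT-PLAN-v5 dc7ff9950b0ac185,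
§ F4′-4).  `--kind proof --supports stmt-QuantumFields-27238 --as helper`; count-neutral.  [B7] = [Balaban1985Averaging]; [B11] = [Balaban1985Variational]; [I] = [Balaban1987RG1].

THE MATHEMATICS.  `U₀ : T^{(0)} → SU(N)` with the (0.4) guard below `k` and a LOOP PROFILE of its real tower `W_j = Ū^j U₀`: `‖W_j(loop) − 1‖ ≤ ε_j` (j < k), `Σ_{j<k} ε_j ≤ E₀`
([B9] (3.129)∕[B11] (14) at all scales — in print `ε_j ~ dL²·αL^{2(j−k)}`).  `X` TRACELESS with `L^k‖X‖_∞ ≤ ρ₀(d, L)`, `V₀ = e^{iX}U₀`.  INVARIANT at level `j ≤ k`: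
`Ū^j_h(V₀) = G_j • Ṽ_j` with `G_j : T^{(j)} → SL(N,ℂ)`, `‖G_j − 1‖ ≤ 64d·L^j s₀`, `det Ṽ_j = 1`, `‖Ṽ_j(b)W_j(b)⋆ − 1‖ ≤ S_j := L^j s₀(1 + 2Q_j)`, `s₀ = 2‖X‖_∞`,
`Q_j = Σ_{i<j} (2A·L^i s₀ + B·ε_i)`, `A = 2·10⁷(d+1)²L`, `B = 6·10⁴(d+1)` — by induction with F4′-3b's `exists_regauge` (consolidated: `S′ ≤ L·S·(1 + A·S + B·ε)`) and F4′-1's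
covariance `Ū_h(G • Ṽ) = (G∘emb) • Ū_h(Ṽ)`.  Since `Σ_{i<k} L^i ≤ L^k`, `Q_k ≤ 2A·L^k s₀ + B·E₀ ≤ 1∕2`: the product of the one-step factors converges GEOMETRICALLY FROM THE TOP — the
k-uniformity mechanism of [B7] Prop. 3∕7 («the constant C₁ depends on d and c₃ depends on d and L»).  OUTPUTS: (a) all loop matrices of `Ū^j_h(V₀)`, `j < k`, are within `1∕2` of `1`
(the POLYDISC letter of ✓`Node00.analyticAt_COfRecord`); (b) `‖Ū^k_h(V₀)(c)·Ū^k(U₀)(c)⋆ − 1‖ ≤ 800(d+1)·L^k‖X‖_∞` (the LOG-DISC letter and the linear bound F4′-0 consumes).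

WHAT IS PROVED (0 def, 0 sorry, axioms standard; ns `Summit.QuantumFields.YangMills.Theorems.C44IterMh`).
* §1 real bookkeeping: `consolidated_step_le` (`(1+S)^L − 1 + 1.2·10⁶κ² + 1.3·10⁴εκ ≤ L·S·(1 + A S + B ε)`, `κ ≤ 4(d+1)LS`), `geom_sum_pow_le_pow` (`Σ_{i<k} L^i ≤ L^k`),
  `gauge_step_real`, `dev_step_real`.
* §2 level `0`: `det_expOver_eq_one` (traceless ⇒ `SL(N,ℂ)`), `norm_expOver_mul_star_sub_one_le` (`‖e^{iX_b}U₀(b)U₀(b)⋆ − 1‖ ≤ 2‖X‖`), `coe_iter_succ_eq_avgMh`.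
* §3 `accumQ_le` (`Q_j ≤ 1∕2`), `gauge_step_real`, `dev_step_real` (real bookkeeping), ★★★ `tower_induction` — the invariant at every `j ≤ k`.
  (The two OUTPUT letters — polydisc (a) and log-disc∕linear bound (b) — are read off in the sequel `…C44IterMhPolydisc`.)

HONEST FRAMING.  A genuine k-uniform estimate with crude explicit constants (`ρ₀ = (10⁹(d+1)²L)⁻¹`, `E₀ = (10⁶(d+1))⁻¹`), for the TRACELESS slice and under a DISPLAYED loop profile of
the background tower; it is NOT [B7] Props 1–3∕7 as printed (sup-norm perturbations only, no Hölder data), and nothing of [B11] (44) beyond its polydisc∕log-disc letters is asserted here.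
(ℓa-C)(ℓa-H)(ℓd) DISPLAYED; (R1)∕(R2) OPEN; K0ᴬ ⟨stmt-QuantumFields-27238⟩ NOT closed; K0ᴬ∕K1ᴬ∕K3ᴬ 0∕3; NODE O 0∕1; COUNT 8∕28 · K 1∕4 UNMOVED; finite `𝕋⁴_{L^K}` at fixed ε — NOT
continuum ∕ ℝ⁴ ∕ OS; **the Yang–Mills mass gap (Clay) is NOT proved by any of this.**  No `sorry`, `instance`, `notation`, `set_option`; standard axioms.
-/

noncomputable section

open scoped Matrix Matrix.Norms.L2Operator

namespace Summit.QuantumFields.YangMills.Theorems.C44IterMh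

open Literature.MathematicalPhysics.QuantumFieldTheory.Balaban1983to89
open Literature.MathematicalPhysics.QuantumFieldTheory.Balaban1983to89.Node00
open T4Continuum BlockAveraging
open B15AveragingHolomorphic (holMh loopMh avgMh iterMh iterMh_zero iterMh_succ coeField_iter_eq_iterMh loopMh_coeField)
open B7TransferAnalyticMean (norm_exp_sub_one_le_two_mul)
open ExpMeanLog (expMeanLogSU)
open NormedSpace (exp)

variable {P : Params} {N : ℕ}

/-! ## §1  Real bookkeeping -/

/-- **THE CONSOLIDATED ONE-STEP RECURSION**: with `φ = (1+2S)^{dL} − 1`, `λ = (1+2S)^L − 1` (so `φ + λ ≤ 4(d+1)LS` when `2dLS ≤ 1`),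
`(1+S)^L − 1 + 1.2·10⁶(φ+λ)² + 1.3·10⁴ε(φ+λ) ≤ L·S·(1 + 2·10⁷(d+1)²L·S + 6·10⁴(d+1)·ε)` — the line term with coefficient exactly `L`, the rest quadratic or `O(ε)`.
[cite: Balaban1985Averaging, (126) p.36, Proposition 3 p.36] -/
theorem consolidated_step_le {d L : ℕ} (hd : 1 ≤ d) (hL : 1 ≤ L) {S ε : ℝ} (hS : 0 ≤ S) (hε : 0 ≤ ε) (hdS : 2 * (d : ℝ) * L * S ≤ 1) :
    ((1 + 2 * S) ^ (d * L) - 1) + ((1 + 2 * S) ^ L - 1) ≤ 4 * ((d : ℝ) + 1) * L * S ∧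
    ((1 + S) ^ L - 1) + 1200000 * (((1 + 2 * S) ^ (d * L) - 1) + ((1 + 2 * S) ^ L - 1)) ^ 2
        + 13000 * ε * (((1 + 2 * S) ^ (d * L) - 1) + ((1 + 2 * S) ^ L - 1))
      ≤ (L : ℝ) * S * (1 + 20000000 * ((d : ℝ) + 1) ^ 2 * L * S + 60000 * ((d : ℝ) + 1) * ε) := by
  have hd' : (1 : ℝ) ≤ d := by exact_mod_cast hd
  have hL' : (1 : ℝ) ≤ L := by exact_mod_cast hL
  have hLS : (L : ℝ) * S ≤ 1 := by nlinarith
  have h2S : 0 ≤ 2 * S := by linarith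
  -- the two power tails
  have hφ := pow_sub_one_sub_le_sq h2S (d * L) (by push_cast; nlinarith)
  have hlam := pow_sub_one_sub_le_sq h2S L (by nlinarith)
  have hline := pow_sub_one_sub_le_sq hS L hLS
  push_cast at hφ
  have hx1 : (d : ℝ) * L * (2 * S) ≤ 1 := by linarith
  have hx0 : 0 ≤ (d : ℝ) * L * (2 * S) := by positivity
  have hxx : ((d : ℝ) * L * (2 * S)) ^ 2 ≤ (d : ℝ) * L * (2 * S) := by nlinarith
  have hy1 : (L : ℝ) * (2 * S) ≤ 1 := by nlinarith
  have hy0 : 0 ≤ (L : ℝ) * (2 * S) := by positivity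
  have hyy : ((L : ℝ) * (2 * S)) ^ 2 ≤ (L : ℝ) * (2 * S) := by nlinarith
  have hφ' : (1 + 2 * S) ^ (d * L) - 1 ≤ 4 * (d : ℝ) * L * S := by linarith
  have hlam' : (1 + 2 * S) ^ L - 1 ≤ 4 * (L : ℝ) * S := by linarith
  have hκ : ((1 + 2 * S) ^ (d * L) - 1) + ((1 + 2 * S) ^ L - 1) ≤ 4 * ((d : ℝ) + 1) * L * S := by nlinarith
  have hκ0 : 0 ≤ ((1 + 2 * S) ^ (d * L) - 1) + ((1 + 2 * S) ^ L - 1) := by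
    have h1 : (1 : ℝ) ≤ (1 + 2 * S) ^ (d * L) := one_le_pow₀ (by linarith)
    have h2 : (1 : ℝ) ≤ (1 + 2 * S) ^ L := one_le_pow₀ (by linarith)
    linarith
  refine ⟨hκ, ?_⟩
  have hsq : (((1 + 2 * S) ^ (d * L) - 1) + ((1 + 2 * S) ^ L - 1)) ^ 2 ≤ (4 * ((d : ℝ) + 1) * L * S) ^ 2 := pow_le_pow_left₀ hκ0 hκ 2
  have hεκ : ε * (((1 + 2 * S) ^ (d * L) - 1) + ((1 + 2 * S) ^ L - 1)) ≤ ε * (4 * ((d : ℝ) + 1) * L * S) := mul_le_mul_of_nonneg_left hκ hε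
  have hLL : (L : ℝ) * L * S * S ≤ (L : ℝ) * L * S * S * ((d : ℝ) + 1) ^ 2 := by
    have : (1 : ℝ) ≤ ((d : ℝ) + 1) ^ 2 := by nlinarith
    have h0 : 0 ≤ (L : ℝ) * L * S * S := by positivity
    nlinarith
  nlinarith [hsq, hεκ, hline, hLL, mul_nonneg hε hS]

/-- `Σ_{i<k} L^i ≤ L^k` for `L ≥ 2`. [folklore] -/
theorem geom_sum_pow_le_pow {L : ℝ} (hL : 2 ≤ L) : ∀ k : ℕ, (Finset.range k).sum (fun i => L ^ i) ≤ L ^ k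
  | 0 => by simp
  | k + 1 => by
    rw [Finset.sum_range_succ, pow_succ]
    have ih := geom_sum_pow_le_pow hL k
    have : 0 ≤ L ^ k := by positivity
    nlinarith

/-- Real bookkeeping of the gauge bound: `(1 + 128d·x)(1 + 2φ) − 1 ≤ 128d·(Lx)` when `2φ ≤ 8(d+1)L·S`, `S ≤ 2x`, `128dx ≤ 1∕2`, `L ≥ 2`, `d ≥ 1`. [folklore] -/
theorem gauge_step_real {d Lr Lj t S φv : ℝ} (hd : 1 ≤ d) (hL : 2 ≤ Lr) (hLj : 0 ≤ Lj) (ht : 0 ≤ t) (hS : S ≤ 2 * (Lj * t)) (hφ0 : 0 ≤ φv)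
    (hφ : 2 * φv ≤ 8 * (d + 1) * Lr * S) (ha : 128 * d * (Lj * t) ≤ 1 / 2) :
    (1 + 128 * d * (Lj * t)) * (1 + 2 * φv) - 1 ≤ 128 * d * (Lj * Lr * t) := by
  have hx : 0 ≤ Lj * t := mul_nonneg hLj ht
  have hL0 : 0 ≤ Lr := by linarith
  have h8 : (0 : ℝ) ≤ 8 * (d + 1) * Lr := by nlinarith
  have h1 : 2 * φv ≤ 32 * d * Lr * (Lj * t) := by
    nlinarith [mul_le_mul_of_nonneg_left hS h8, mul_nonneg (mul_nonneg hL0 hx) (by linarith : (0:ℝ) ≤ d - 1)]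
  have h2 : 128 * d * (Lj * t) * (2 * φv) ≤ 1 / 2 * (2 * φv) := mul_le_mul_of_nonneg_right ha (by linarith)
  nlinarith [mul_nonneg (mul_nonneg (by linarith : (0:ℝ) ≤ d) (by linarith : (0:ℝ) ≤ Lr)) hx]

/-- Real bookkeeping of the deviation bound: `L·S·(1 + A·S + B·ε) ≤ L^{j+1}s₀·(1 + 2(Q + (2A·L^j s₀ + Bε)))` for `S = L^j s₀(1+2Q)`, `Q ≤ 1∕2`. [folklore] -/
theorem dev_step_real {Lr Lj t Q A B ε : ℝ} (hLr : 0 ≤ Lr) (hLj : 0 ≤ Lj) (ht : 0 ≤ t) (hQ0 : 0 ≤ Q) (hQ : Q ≤ 1 / 2) (hA : 0 ≤ A) (hB : 0 ≤ B) (hε : 0 ≤ ε) :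
    Lr * (Lj * t * (1 + 2 * Q)) * (1 + A * (Lj * t * (1 + 2 * Q)) + B * ε) ≤ Lj * Lr * t * (1 + 2 * (Q + (A * (2 * (Lj * t)) + B * ε))) := by
  have hx : 0 ≤ Lj * t := mul_nonneg hLj ht
  have hS : Lj * t * (1 + 2 * Q) ≤ 2 * (Lj * t) := by nlinarith
  have hq0 : 0 ≤ A * (2 * (Lj * t)) + B * ε := by positivity
  have hAS : A * (Lj * t * (1 + 2 * Q)) ≤ A * (2 * (Lj * t)) := mul_le_mul_of_nonneg_left hS hA
  have hkey : (1 + 2 * Q) * (1 + A * (Lj * t * (1 + 2 * Q)) + B * ε) ≤ 1 + 2 * (Q + (A * (2 * (Lj * t)) + B * ε)) := by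
    nlinarith [mul_nonneg hQ0 hq0]
  have h0 : 0 ≤ Lr * (Lj * t) := mul_nonneg hLr hx
  calc Lr * (Lj * t * (1 + 2 * Q)) * (1 + A * (Lj * t * (1 + 2 * Q)) + B * ε)
      = Lr * (Lj * t) * ((1 + 2 * Q) * (1 + A * (Lj * t * (1 + 2 * Q)) + B * ε)) := by ring
    _ ≤ Lr * (Lj * t) * (1 + 2 * (Q + (A * (2 * (Lj * t)) + B * ε))) := mul_le_mul_of_nonneg_left hkey h0
    _ = Lj * Lr * t * (1 + 2 * (Q + (A * (2 * (Lj * t)) + B * ε))) := by ring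

/-! ## §2  Level `0`: the chart field `e^{iX}U₀` of a TRACELESS `X` is `SL(N,ℂ)`-valued and within `2‖X‖` of `U₀` -/

section LevelZero

variable [NeZero N]

omit [NeZero N] in
/-- `det(e^{iX_b}·U₀(b)) = 1` for traceless `X` (Liouville `det e^{Y} = e^{tr Y}`, `det U₀(b) = 1`). [cite: Balaban1985Averaging, (109) p.34 («A_b ∈ 𝔤ᶜ»); Balaban1985Variational, (51) p.286] -/
theorem det_expOver_eq_one (U₀ : GaugeField P 0 (SU N)) {X : PBond P 0 → Matrix (Fin N) (Fin N) ℂ} (hX : ∀ b, (X b).trace = 0) (b : PBond P 0) :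
    (expOver U₀ X b).det = 1 := by
  rw [expOver_apply, Matrix.det_mul, Literature.Analysis.Matrix.det_exp_eq_exp_trace, Matrix.trace_smul, hX b, smul_zero, NormedSpace.exp_zero, one_mul]
  exact (Matrix.mem_specialUnitaryGroup_iff.1 (U₀ b).2).2

omit [NeZero N] in
/-- `‖e^{iX_b}U₀(b)·U₀(b)⋆ − 1‖ = ‖e^{iX_b} − 1‖ ≤ 2‖X‖` (`‖X‖ ≤ 1`). [cite: Balaban1985Variational, (15) p.280, (51) p.286] -/
theorem norm_expOver_mul_star_sub_one_le (U₀ : GaugeField P 0 (SU N)) {X : PBond P 0 → Matrix (Fin N) (Fin N) ℂ} (hX1 : ‖X‖ ≤ 1) (b : PBond P 0) :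
    ‖expOver U₀ X b * star (U₀ b : Matrix (Fin N) (Fin N) ℂ) - 1‖ ≤ 2 * ‖X‖ := by
  rw [expOver_apply, mul_assoc, Unitary.mul_star_self_of_mem (Matrix.specialUnitaryGroup_le_unitaryGroup (U₀ b).2), mul_one]
  have hb : ‖Complex.I • X b‖ ≤ ‖X‖ := by rw [norm_smul, Complex.norm_I, one_mul]; exact norm_le_pi_norm X b
  exact (norm_exp_sub_one_le_two_mul (hb.trans hX1)).trans (by linarith)

/-- Under the guard below `j+1`: the matrix of `Ū^{j+1}U₀` at `c` is `avgMh ↑(Ū^jU₀) c`. [cite: Balaban1987RG1, (0.4) p.253, (0.21) p.256] -/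
theorem coe_iter_succ_eq_avgMh {U₀ : GaugeField P 0 (SU N)} {j : ℕ} (h : SmallBelow (fun j => blockAvg (P := P) (j := j) expMeanLogSU) (j + 1) U₀) (c : PBond P (j + 1)) :
    ((Averaging.iter (fun j => blockAvg (P := P) (j := j) expMeanLogSU) (j + 1) U₀ c : SU N) : Matrix (Fin N) (Fin N) ℂ) =
      avgMh (coeField (Averaging.iter (fun j => blockAvg (P := P) (j := j) expMeanLogSU) j U₀)) c := by
  have h1 := congrFun (coeField_iter_eq_iterMh (j + 1) h) c
  rw [iterMh_succ, ← coeField_iter_eq_iterMh j (h.mono (Nat.le_succ j))] at h1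
  exact h1

end LevelZero

/-! ## §3  The induction over levels -/

section Tower

variable [NeZero N]

/-- The accumulated smallness `Q_j = Σ_{i<j} (2A·L^i s₀ + B·ε_i)` is nonnegative, monotone, and `≤ 1∕2` under the top-scale hypothesis (`Σ_{i<k} L^i ≤ L^k`). [folklore] -/
theorem accumQ_le {A B s₀ Lr : ℝ} (hA : 0 ≤ A) (hB : 0 ≤ B) (hs₀ : 0 ≤ s₀) (hL : 2 ≤ Lr) {εs : ℕ → ℝ} (hε0 : ∀ j, 0 ≤ εs j) {k : ℕ}
    (hQ : 2 * A * (Lr ^ k * s₀) + B * (Finset.range k).sum εs ≤ 1 / 2) {j : ℕ} (hj : j ≤ k) :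
    0 ≤ (Finset.range j).sum (fun i => A * (2 * (Lr ^ i * s₀)) + B * εs i) ∧
      (Finset.range j).sum (fun i => A * (2 * (Lr ^ i * s₀)) + B * εs i) ≤ 1 / 2 := by
  have hL0 : 0 ≤ Lr := by linarith
  have hterm : ∀ i, 0 ≤ A * (2 * (Lr ^ i * s₀)) + B * εs i := fun i => by have := hε0 i; positivity
  refine ⟨Finset.sum_nonneg fun i _ => hterm i, ?_⟩
  have hmono : (Finset.range j).sum (fun i => A * (2 * (Lr ^ i * s₀)) + B * εs i) ≤ (Finset.range k).sum (fun i => A * (2 * (Lr ^ i * s₀)) + B * εs i) :=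
    Finset.sum_le_sum_of_subset_of_nonneg (Finset.range_mono hj) fun i _ _ => hterm i
  refine hmono.trans ?_
  have hsplit : (Finset.range k).sum (fun i => A * (2 * (Lr ^ i * s₀)) + B * εs i)
      = 2 * A * ((Finset.range k).sum (fun i => Lr ^ i) * s₀) + B * (Finset.range k).sum εs := by
    rw [Finset.sum_add_distrib, ← Finset.mul_sum, ← Finset.mul_sum, ← Finset.mul_sum, Finset.sum_mul]; ring
  rw [hsplit]
  have hg := mul_le_mul_of_nonneg_right (geom_sum_pow_le_pow hL k) hs₀
  have h2A : 0 ≤ 2 * A := by positivity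
  nlinarith [mul_le_mul_of_nonneg_left hg h2A]

/-- ★★★ **THE TOWER INDUCTION.**  For `U₀` guarded below `k` with loop profile `ε` of its real tower and a TRACELESS `X`, under the smallness hypotheses
(`A = 2·10⁷(d+1)²L`, `B = 6·10⁴(d+1)`, `s₀ = 2‖X‖`): at every level `j ≤ k` the holomorphic iterate of `e^{iX}U₀` is a complex gauge transform `G_j • Ṽ_j` with `G_j : T^{(j)} → SL(N,ℂ)`,
`‖G_j − 1‖ ≤ 128d·L^j s₀`, `det Ṽ_j = 1`, `‖Ṽ_j(b)·Ū^j(U₀)(b)⋆ − 1‖ ≤ L^j s₀ (1 + 2Q_j)`.  [B7] Sect. B∕D's moving frames, complex sup-norm edition, iterated with geometric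
convergence FROM THE TOP. [cite: Balaban1985Averaging, Proposition 3 p.36, Proposition 7 p.43, (58) p.27; Balaban1987RG1, (0.21) p.256, (0.8) p.253] -/
theorem tower_induction (U₀ : GaugeField P 0 (SU N)) (k : ℕ) (hU₀ : SmallBelow (fun j => blockAvg (P := P) (j := j) expMeanLogSU) k U₀)
    (εs : ℕ → ℝ) (hε0 : ∀ j, 0 ≤ εs j)
    (hε : ∀ j, j < k → ∀ (c : PBond P (j + 1)) (i : Idx P), ‖loopM (coeField (Averaging.iter (fun j => blockAvg (P := P) (j := j) expMeanLogSU) j U₀)) c i - 1‖ ≤ εs j)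
    (hε50 : ∀ j, j < k → εs j ≤ 1 / 50)
    {X : PBond P 0 → Matrix (Fin N) (Fin N) ℂ} (hX : ∀ b, (X b).trace = 0)
    (hρ : 8 * ((P.d : ℝ) + 1) * ((P.L : ℝ) ^ k * (2 * ‖X‖)) ≤ 1 / 10 ^ 6)
    (hQ : 2 * (20000000 * ((P.d : ℝ) + 1) ^ 2 * P.L) * ((P.L : ℝ) ^ k * (2 * ‖X‖)) + (60000 * ((P.d : ℝ) + 1)) * (Finset.range k).sum εs ≤ 1 / 2)
    (hN : ∀ j, j < k → (N : ℝ) * (56 * ((P.d : ℝ) + 1) * ((P.L : ℝ) ^ k * (2 * ‖X‖)) + εs j) ≤ 3) :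
    ∀ j, j ≤ k → ∃ (G : Site P j → Matrix (Fin N) (Fin N) ℂ) (Vt : PBond P j → Matrix (Fin N) (Fin N) ℂ),
      (∀ x, (G x).det = 1) ∧ (∀ x, ‖G x - 1‖ ≤ 128 * (P.d : ℝ) * ((P.L : ℝ) ^ j * (2 * ‖X‖))) ∧ (∀ b, (Vt b).det = 1) ∧
      (∀ b, ‖Vt b * star ((Averaging.iter (fun j => blockAvg (P := P) (j := j) expMeanLogSU) j U₀ b : SU N) : Matrix (Fin N) (Fin N) ℂ) - 1‖ ≤
        (P.L : ℝ) ^ j * (2 * ‖X‖) * (1 + 2 * (Finset.range j).sum (fun i => (20000000 * ((P.d : ℝ) + 1) ^ 2 * P.L) * (2 * ((P.L : ℝ) ^ i * (2 * ‖X‖))) + (60000 * ((P.d : ℝ) + 1)) * εs i))) ∧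
      (iterMh j (expOver U₀ X) = fun b => G b.src * Vt b * (G b.tgt)⁻¹) := by
  -- constants
  have hd1 : (1 : ℝ) ≤ P.d := by exact_mod_cast P.hd
  have hL2 : (2 : ℝ) ≤ P.L := by exact_mod_cast P.hL.2
  have hL1 : (1 : ℝ) ≤ P.L := by linarith
  have hs₀ : 0 ≤ 2 * ‖X‖ := by positivity
  have hA : (0 : ℝ) ≤ 20000000 * ((P.d : ℝ) + 1) ^ 2 * P.L := by positivity
  have hB : (0 : ℝ) ≤ 60000 * ((P.d : ℝ) + 1) := by positivity
  have hρ0 : 0 ≤ (P.L : ℝ) ^ k * (2 * ‖X‖) := by positivity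
  have hX1 : ‖X‖ ≤ 1 := by
    have : (1 : ℝ) ≤ (P.L : ℝ) ^ k := one_le_pow₀ hL1
    nlinarith [norm_nonneg X]
  intro j
  induction j with
  | zero =>
    intro _
    refine ⟨fun _ => 1, expOver U₀ X, fun _ => Matrix.det_one, fun _ => by rw [sub_self, norm_zero]; positivity, det_expOver_eq_one U₀ hX, fun b => ?_, ?_⟩
    · rw [pow_zero, one_mul, Finset.range_zero, Finset.sum_empty, mul_zero, add_zero, mul_one]
      exact norm_expOver_mul_star_sub_one_le U₀ hX1 b
    · funext b
      rw [iterMh_zero, inv_one, one_mul, mul_one]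
  | succ j ih =>
    intro hjk
    have hjk' : j < k := hjk
    obtain ⟨G, Vt, hGdet, hGn, hVdet, hVn, hiter⟩ := ih hjk'.le
    -- the level-j sizes
    have hLj : (P.L : ℝ) ^ (j + 1) ≤ (P.L : ℝ) ^ k := pow_le_pow_right₀ hL1 hjk
    have hLj' : (P.L : ℝ) ^ j * (2 * ‖X‖) * P.L ≤ (P.L : ℝ) ^ k * (2 * ‖X‖) := by
      rw [mul_assoc, mul_comm (2 * ‖X‖), ← mul_assoc, ← pow_succ]; exact mul_le_mul_of_nonneg_right hLj hs₀
    obtain ⟨hQ0, hQh⟩ := accumQ_le hA hB hs₀ hL2 hε0 hQ hjk'.le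
    set Qj := (Finset.range j).sum (fun i => (20000000 * ((P.d : ℝ) + 1) ^ 2 * P.L) * (2 * ((P.L : ℝ) ^ i * (2 * ‖X‖))) + (60000 * ((P.d : ℝ) + 1)) * εs i) with hQj
    set Sj := (P.L : ℝ) ^ j * (2 * ‖X‖) * (1 + 2 * Qj) with hSj
    have hSj0 : 0 ≤ Sj := by positivity
    have hx0 : 0 ≤ (P.L : ℝ) ^ j * (2 * ‖X‖) := mul_nonneg (pow_nonneg (by linarith only [hL1]) j) hs₀
    have hSj2 : Sj ≤ 2 * ((P.L : ℝ) ^ j * (2 * ‖X‖)) := by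
      rw [hSj]; nlinarith only [hx0, hQh]
    have hLS : (P.L : ℝ) * Sj ≤ 2 * ((P.L : ℝ) ^ k * (2 * ‖X‖)) := by
      have := mul_le_mul_of_nonneg_left hSj2 (by linarith only [hL1] : (0:ℝ) ≤ P.L)
      nlinarith only [this, hLj']
    have hd0 : (0 : ℝ) ≤ P.d := by linarith only [hd1]
    have hdS : 2 * (P.d : ℝ) * P.L * Sj ≤ 1 := by
      have := mul_le_mul_of_nonneg_left hLS hd0
      nlinarith only [this, hρ, hd0, hρ0]
    obtain ⟨hκ4, hstep⟩ := consolidated_step_le P.hd P.hL.2.le hSj0 (hε0 j) hdS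
    have hκ8 : 4 * ((P.d : ℝ) + 1) * P.L * Sj ≤ 8 * ((P.d : ℝ) + 1) * ((P.L : ℝ) ^ k * (2 * ‖X‖)) := by
      have := mul_le_mul_of_nonneg_left hLS (by linarith only [hd1] : (0:ℝ) ≤ 4 * ((P.d : ℝ) + 1))
      nlinarith only [this]
    have hκ : ((1 + 2 * Sj) ^ (P.d * P.L) - 1) + ((1 + 2 * Sj) ^ P.L - 1) ≤ 1 / 10 ^ 6 := by linarith only [hκ4, hκ8, hρ]
    have hNj : (N : ℝ) * (7 * (((1 + 2 * Sj) ^ (P.d * P.L) - 1) + ((1 + 2 * Sj) ^ P.L - 1)) + εs j) ≤ 3 := by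
      refine le_trans (mul_le_mul_of_nonneg_left ?_ (Nat.cast_nonneg _)) (hN j hjk')
      linarith only [hκ4, hκ8]
    -- one step
    obtain ⟨H, V', hHdet, hHn, havg, hV'det, hV'n⟩ :=
      exists_regauge (Averaging.iter (fun j => blockAvg (P := P) (j := j) expMeanLogSU) j U₀) hVdet hVn le_rfl le_rfl (hε j hjk') hκ (hε50 j hjk') hNj
    refine ⟨fun y => G (emb y) * H y, V', fun y => by rw [Matrix.det_mul, hGdet, hHdet, one_mul], fun y => ?_, hV'det, fun c => ?_, ?_⟩
    · -- the gauge bound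
      have h1 : (1 : ℝ) ≤ (1 + 2 * Sj) ^ P.L := one_le_pow₀ (by linarith only [hSj0])
      have h1' : (1 : ℝ) ≤ (1 + 2 * Sj) ^ (P.d * P.L) := one_le_pow₀ (by linarith only [hSj0])
      have hφ0 : 0 ≤ (1 + 2 * Sj) ^ (P.d * P.L) - 1 := by linarith only [h1']
      have hφ2 : 2 * ((1 + 2 * Sj) ^ (P.d * P.L) - 1) ≤ 8 * ((P.d : ℝ) + 1) * P.L * Sj := by linarith only [hκ4, h1]
      refine (norm_mul_sub_one_le_of_le₂ (hGn (emb y)) (hHn y)).trans ?_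
      have hg1 : 128 * (P.d : ℝ) * ((P.L : ℝ) ^ j * (2 * ‖X‖)) ≤ 1 / 2 := by
        have : (P.L : ℝ) ^ j * (2 * ‖X‖) ≤ (P.L : ℝ) ^ k * (2 * ‖X‖) :=
          mul_le_mul_of_nonneg_right (pow_le_pow_right₀ hL1 hjk'.le) hs₀
        have := mul_le_mul_of_nonneg_left this hd0
        linarith only [this, hρ, hd1, hρ0]
      rw [pow_succ]
      exact gauge_step_real hd1 hL2 (pow_nonneg (by linarith only [hL1]) j) hs₀ hSj2 hφ0 hφ2 hg1
    · -- the deviation bound at level j+1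
      rw [coe_iter_succ_eq_avgMh (hU₀.mono hjk) c]
      refine (hV'n c).trans (hstep.trans ?_)
      rw [Finset.sum_range_succ, pow_succ, hSj]
      exact dev_step_real (by linarith only [hL1]) (pow_nonneg (by linarith only [hL1]) j) hs₀ hQ0 hQh hA hB (hε0 j)
    · -- the gauge identity at level j+1
      have hcov := avgMh_gaugeSL_eq G hGdet Vt
      rw [iterMh_succ, hiter, hcov]
      funext c
      rw [havg c, Matrix.mul_inv_rev (G (emb c.tgt)) (H c.tgt)]
      simp only [mul_assoc]

end Tower

end Summit.QuantumFields.YangMills.Theorems.C44IterMh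

end
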